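/-
Copyright (c) 2026. All rights reserved.
Released under Apache 2.0 license as described in the file LICENSE.
-/
import Literature.Probability.FitznerVanDerHofstad2017.NobleBoundsNMidSZero
import Literature.Probability.FitznerVanDerHofstad2017.NobleBoundsN1Class01
import Literature.Probability.FitznerVanDerHofstad2017.NobleBoundsN1IotaPartIII
import HarnessLib

/-!
# Fitzner–van der Hofstad (2017), §6.1 (6.4) / App. B: term-2 packages of a middle junction, variant `F′`

[FvdH17] = R. Fitzner, R. van der Hofstad, *Mean-field behavior for nearest-neighbor percolation in `d > 10`*,
arXiv:1506.07977v2 (EJP 22 (2017), paper 43).  Page numbers refer to the arXiv version.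

(6.4) of [FvdH17] (p. 58) bounds the `N`-th NoBLE coefficient by the chain `S · B ⋯ B · Ā · P^E`; its typed form
`prod_bondJ_mul_piPerc_jwCover_le_chain_of_packages` (`NobleBoundsNGrouped`) consumes one letter package `JPkg`
per junction of every variant piece, and `NobleBoundsNJointKit.nonempty_jPkg_of_joint` builds such a package from
a grouping of the junction's lines into letters, upgraded line events and one letter estimate (the term-1 cells of
variant `F‴` are `NobleBoundsNMidS`).  At a MIDDLE junction `k` (`1 ≤ k ≤ M`) the pointwise middle block (5.4)
(p. 48) is `Σ_c A^{κ,a,c,*}(u,w,t,z) A^{c,a′}(t,z,w′,u′) + δ_{z,t} A^{κ,a,a′}(u,w,w′,t) P^0(u′−t,u′−t) + B^{(2)}`.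
This module serves the variant `F′` of level `k + 1` — kind `midE` ((4.59), p. 41: "`F′`: the last sausage is
trivial, `t_i = z_i = b̲_i`, and the exit `w_i` lies on the path from `b̄_{i-1}`") — i.e. the parameter regime
`t_k = u_{k+1}` of a `midE` level (then `z_k = t_k` by the canonical clause `(z = b̲ ↔ t = b̲)`, and the three
sausage slots of the level are loops): it is covered by the SECOND TERM of (5.4) at its internal vertex `u = t_k =
u_{k+1}`, where `δ_{z,t} = 1` and `P^0(0,0) = 1`, i.e. by the open triangle with one pivotal edge
`A^{κ,a,a′}(u_k, w_k, w_{k+1}, t_k)` of App. B (Table "Diagrams and definition of `A^{ι,a,b}(0,v,x,y)`", p. 75) in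
the frame `(0, e, v, x, y) = (u_k, b̄_k, w_k, w_{k+1}, t_k)` ([FvdH17] §6.1 "Bound for Ξ^{(N)}", Cases
`a = 0 / 1 / ≥ 2` × `b = 0 / 1 / ≥ 2`, pp. 58–59):

* pivotal bond `{u ←1̲→ b̄}` (line `0 → e`, index `1̲`), on level `k`;
* entry line `{b̄ ↔ w′}` of level `k + 1` (line `e → x`; index `0`, or `1` when `x ≠ e` is forced — rows
  `(·,0)`, where `x = y = z_k ≠ b̄_k` because `b̄_k ∉ C̃_k ∋ z_k`);
* the class-`a′` leg `{w′ ↔ t}` of level `k + 1` (line `x → y`): trivial for `a′ = 0` (`w′ = u′ = t`), the open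
  bond `{w′, t}` itself for `a′ = 1` (normal form (10) of the joint witnesses, `NobleJointNLevel.Conds.wyNF_midE`),
  a path of length `≥ 2` for `a′ = 2` (the bond is not open);
* the exit line `{w_k ↔ z_k = t}` of level `k` reversed (line `y → v`; index `0`, or `1` in rows `a = 0` where
  `v = 0` and `y ≠ 0` by vacancy; `2` in the sub-row `x = e` of row `(0,1)` by parity: `t ∼ b̄ ∼ u`, `t ≠ u`).

The only cross-level letter joins the bond and the exit line of level `k` with the ENTRY slots `0, 1` of the `midE`
level `k + 1` — the grouping rule of §4.4 after (4.65) (p. 43), certified by `JFacts.cross`.  Row `(0,0)` is served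
against the PRIMED family `blockAiota'` of `NobleBlocksPrime`, i.e. the §6.1 display `T_{1̲,1,1}(e, x, 0)`
(Case `a = 0, b = 0`, p. 59); the App. B order `T_{1,1̲,1}` of that row would put the exact-length index on the
entry line `b̄ → w′` and is not what the case analysis yields (DIVERGENCE D74 (i) of the b2b-lace packet; nothing
printed is asserted false here — the primed family is an additive reading, equal to the landed one off `(0,0)`).

§A the App. B rows as letter inequalities; §B the `midE` level and the facts of the regime `t = u′` in closed
form; §C the letter of term 2 and its two-level readings; §D the packages: `nonempty_jPkg_midF1_zero'` (rows
`(a,0)`, primed), `nonempty_jPkg_midF1_one` (rows `(a,1)`), `nonempty_jPkg_midF1_two` (rows `(a,2)`), the master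
`nonempty_jPkg_midF1'` / `nonempty_jPkg_midF1` and the corollaries in the literal shape of the second term of
`NobleBlocksPointwise.blockBpt`, `δ_{z,t} (A^{κ,a,a′}(u,w,w′,t) P^{S,0}(u′−t,u′−t))`.

Conventions: `d`-generic; nothing is cited as a fact; additive (no existing declaration is changed).  The
junction is written `k = i.castSucc = i₀.succ` (`i i₀ : Fin (M+1)`), as in `NobleBoundsNMidS`.
-/

noncomputable section

namespace Literature.Probability.FitznerVanDerHofstad2017

open Literature.Barriers.CriticalPhenomena Literature.Probability.Percolation
open Literature.Probability.LatticeModels Literature.Combinatorics.SimpleGraph _root_.SimpleGraph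
open _root_.MeasureTheory
open Literature.Probability.FitznerVanDerHofstad2017.NobleBlocks
open Literature.Probability.FitznerVanDerHofstad2017.NobleBlocks.LenIdx
open scoped ENNReal

variable {d : ℕ}

/-! ### A. The App. B rows of `A^{ι,a,b}` as letter inequalities -/

section Rows

variable (p : unitInterval)

/-- Row `a = 1, b = 0` of the `A^{ι,a,b}` table: `A^{ι,1,0}(0,v,x,y) = δ_{x,y} (1−δ_{x,0}) 2dD(v) T_{1̲,1,0}(e,x,v)`.
[cite: FitznerVanDerHofstad2017, App. B Table "definition of A^{ι,a,b}(0,v,x,y)", row a = 1, b = 0 (arXiv:1506.07977v2 p. 75)] -/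
theorem blockAiota₀_one_zero (L : Letters d) (ι : Fin d × Bool) (v x y : Site d) :
    blockAiota₀ L ι 1 0 v x y = kd x y * kdc x 0 * twoDD v * L.T (eq 1) (ge 1) (ge 0) (stepVec ι) x v := rfl

/-- Row `a ≥ 2, b = 0` of the `A^{ι,a,b}` table: `A^{ι,2,0}(0,v,x,y) = δ_{x,y} T_{1̲,1,0}(e,x,v)`.
[cite: FitznerVanDerHofstad2017, App. B Table "definition of A^{ι,a,b}(0,v,x,y)", row a ≥ 2, b = 0 (arXiv:1506.07977v2 p. 75)] -/
theorem blockAiota₀_two_zero (L : Letters d) (ι : Fin d × Bool) (v x y : Site d) :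
    blockAiota₀ L ι 2 0 v x y = kd x y * L.T (eq 1) (ge 1) (ge 0) (stepVec ι) x v := rfl

/-- Row `a = 0, b = 1` of the `A^{ι,a,b}` table:
`A^{ι,0,1}(0,v,x,y) = δ_{v,0} (1−δ_{y,v}) (δ_{x,e} T_{1̲,1̲,2}(e,y,0) + S_{1̲,1,1̲,1}(e,x,y,0))`.
[cite: FitznerVanDerHofstad2017, App. B Table "definition of A^{ι,a,b}(0,v,x,y)", row a = 0, b = 1 (arXiv:1506.07977v2 p. 75)] -/
theorem blockAiota₀_zero_one (L : Letters d) (ι : Fin d × Bool) (v x y : Site d) :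
    blockAiota₀ L ι 0 1 v x y = kd v 0 * kdc y v *
      (kd x (stepVec ι) * L.T (eq 1) (eq 1) (ge 2) (stepVec ι) y 0 +
        L.S (eq 1) (ge 1) (eq 1) (ge 1) (stepVec ι) x y 0) := rfl

/-- Row `a = 1, b = 1` of the `A^{ι,a,b}` table: `A^{ι,1,1}(0,v,x,y) = 2dD(v) S_{1̲,0,1̲,0}(e,x,y,v)`.
[cite: FitznerVanDerHofstad2017, App. B Table "definition of A^{ι,a,b}(0,v,x,y)", row a = 1, b = 1 (arXiv:1506.07977v2 p. 75)] -/
theorem blockAiota₀_one_one (L : Letters d) (ι : Fin d × Bool) (v x y : Site d) :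
    blockAiota₀ L ι 1 1 v x y = twoDD v * L.S (eq 1) (ge 0) (eq 1) (ge 0) (stepVec ι) x y v := rfl

/-- Row `a ≥ 2, b = 1` of the `A^{ι,a,b}` table: `A^{ι,2,1}(0,v,x,y) = S_{1̲,0,1̲,0}(e,x,y,v)`.
[cite: FitznerVanDerHofstad2017, App. B Table "definition of A^{ι,a,b}(0,v,x,y)", row a ≥ 2, b = 1 (arXiv:1506.07977v2 p. 75)] -/
theorem blockAiota₀_two_one (L : Letters d) (ι : Fin d × Bool) (v x y : Site d) :
    blockAiota₀ L ι 2 1 v x y = L.S (eq 1) (ge 0) (eq 1) (ge 0) (stepVec ι) x y v := rfl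

/-- Row `a = 0, b ≥ 2` of the `A^{ι,a,b}` table:
`A^{ι,0,2}(0,v,x,y) = δ_{v,0} (1−δ_{y,0}) (1−δ_{x,0}) S_{1̲,0,2,1}(e,x,y,0)`.
[cite: FitznerVanDerHofstad2017, App. B Table "definition of A^{ι,a,b}(0,v,x,y)", row a = 0, b ≥ 2 (arXiv:1506.07977v2 p. 75)] -/
theorem blockAiota₀_zero_two (L : Letters d) (ι : Fin d × Bool) (v x y : Site d) :
    blockAiota₀ L ι 0 2 v x y = kd v 0 * kdc y 0 * kdc x 0 * L.S (eq 1) (ge 0) (ge 2) (ge 1) (stepVec ι) x y 0 :=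
  rfl

/-- Row `a = 1, b ≥ 2` of the `A^{ι,a,b}` table: `A^{ι,1,2}(0,v,x,y) = 2dD(v) S_{1̲,0,2,0}(e,x,y,v)`.
[cite: FitznerVanDerHofstad2017, App. B Table "definition of A^{ι,a,b}(0,v,x,y)", row a = 1, b ≥ 2 (arXiv:1506.07977v2 p. 75)] -/
theorem blockAiota₀_one_two (L : Letters d) (ι : Fin d × Bool) (v x y : Site d) :
    blockAiota₀ L ι 1 2 v x y = twoDD v * L.S (eq 1) (ge 0) (ge 2) (ge 0) (stepVec ι) x y v := rfl

/-- Row `a ≥ 2, b ≥ 2` of the `A^{ι,a,b}` table: `A^{ι,2,2}(0,v,x,y) = S_{1̲,0,2,0}(e,x,y,v)`.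
[cite: FitznerVanDerHofstad2017, App. B Table "definition of A^{ι,a,b}(0,v,x,y)", row a ≥ 2, b ≥ 2 (arXiv:1506.07977v2 p. 75)] -/
theorem blockAiota₀_two_two (L : Letters d) (ι : Fin d × Bool) (v x y : Site d) :
    blockAiota₀ L ι 2 2 v x y = L.S (eq 1) (ge 0) (ge 2) (ge 0) (stepVec ι) x y v := rfl

/-- **Row `(0,0)` in the §6.1 reading (primed) as a three-line letter on two levels**: for `w = u`, `x = y`
(`w′ = t`), the lines `{u ←1̲→ v}`, `{v ←1→ w′}`, `{w′ ←1→ u}` are bounded by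
`A'^{ι,0,0}(u,u,w′,w′) = T_{1̲,1,1}(v−u, w′−u, 0)` (`w′ ≠ v`, `w′ ≠ u`).
[cite: FitznerVanDerHofstad2017, §6.1 "Case a = 0 and b = 0" (arXiv:1506.07977v2 p. 59); App. B (p. 75)] -/
theorem piPerc_midF1_zero_zero_le_blockAiota' {ι : Fin d × Bool} {u v w' : Site d} (hv : v = u + stepVec ι)
    (hwv : w' ≠ v) (hwu : w' ≠ u) (c : Fin 3 → Fin 2) :
    piPerc d p 2 (genDisjOcc ![event (eq 1) u v, event (ge 1) v w', event (ge 1) w' u] c) ≤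
      blockAiota' (Letters.perc d p) ι 0 0 u u w' w' := by
  have he : v - u = stepVec ι := by rw [hv, add_sub_cancel_left]
  have hx : w' - u ≠ stepVec ι := by rw [← he]; exact fun h => hwv (sub_left_injective h)
  rw [blockAiota', ofBase, blockAiota₀'_zero_zero, sub_self, kd_self, kd_self, kdc_comm,
    kdc_of_ne (sub_ne_zero.2 hwu), kdc_of_ne hx, one_mul, one_mul, one_mul, one_mul, ← he]
  have h := piPerc_genDisjOcc_le_T p (eq 1) (ge 1) (ge 1) u v w' u c
  rw [sub_self] at h
  exact h

/-- **Row `(1,0)` as a three-line letter on two levels**: for `(u,w)` a lattice bond and `x = y` (`w′ = t ≠ u`),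
the lines `{u ←1̲→ v}`, `{v ←1→ w′}`, `{w′ ↔ w}` are bounded by `A^{ι,1,0}(u,w,w′,w′)`.
[cite: FitznerVanDerHofstad2017, §6.1 "Case a = 1" (arXiv:1506.07977v2 p. 59); App. B row a = 1, b = 0 (p. 75)] -/
theorem piPerc_midF1_one_zero_le_blockAiota {ι κ' : Fin d × Bool} {u v w w' : Site d} (hv : v = u + stepVec ι)
    (hw : w = u + stepVec κ') (hwu : w' ≠ u) (c : Fin 3 → Fin 2) :
    piPerc d p 2 (genDisjOcc ![event (eq 1) u v, event (ge 1) v w', event (ge 0) w' w] c) ≤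
      blockAiota (Letters.perc d p) ι 1 0 u w w' w' := by
  have he : v - u = stepVec ι := by rw [hv, add_sub_cancel_left]
  have hk : w - u = stepVec κ' := by rw [hw, add_sub_cancel_left]
  rw [blockAiota, ofBase, blockAiota₀_one_zero, kd_self, kdc_of_ne (sub_ne_zero.2 hwu), hk, twoDD_stepVec,
    one_mul, one_mul, one_mul, ← hk, ← he]
  exact piPerc_genDisjOcc_le_T p (eq 1) (ge 1) (ge 0) u v w' w c

/-- **Row `(2,0)` as a three-line letter on two levels**: for `x = y` (`w′ = t`) the lines `{u ←1̲→ v}`,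
`{v ←1→ w′}`, `{w′ ↔ w}` are bounded by `A^{ι,2,0}(u,w,w′,w′)`.
[cite: FitznerVanDerHofstad2017, §6.1 "Case a ≥ 2" (arXiv:1506.07977v2 p. 59); App. B row a ≥ 2, b = 0 (p. 75)] -/
theorem piPerc_midF1_two_zero_le_blockAiota {ι : Fin d × Bool} {u v w w' : Site d} (hv : v = u + stepVec ι)
    (c : Fin 3 → Fin 2) :
    piPerc d p 2 (genDisjOcc ![event (eq 1) u v, event (ge 1) v w', event (ge 0) w' w] c) ≤
      blockAiota (Letters.perc d p) ι 2 0 u w w' w' := by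
  have he : v - u = stepVec ι := by rw [hv, add_sub_cancel_left]
  rw [blockAiota, ofBase, blockAiota₀_two_zero, kd_self, one_mul, ← he]
  exact piPerc_genDisjOcc_le_T p (eq 1) (ge 1) (ge 0) u v w' w c

/-- **Row `(0,1)`, sub-row `x = e`, as a three-line letter on two levels**: for `w = u`, `w′ = v` the lines
`{u ←1̲→ v}`, `{v ←1̲→ t}`, `{t ←2→ u}` (`t ≠ u`) are bounded by `A^{ι,0,1}(u,u,v,t)` (its summand
`δ_{x,e} T_{1̲,1̲,2}(e,y,0)`).
[cite: FitznerVanDerHofstad2017, §6.1 "Case a = 0" (arXiv:1506.07977v2 p. 58); App. B row a = 0, b = 1 (p. 75)] -/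
theorem piPerc_midF1_zero_one_e_le_blockAiota {ι : Fin d × Bool} {u v t : Site d} (hv : v = u + stepVec ι)
    (htu : t ≠ u) (c : Fin 3 → Fin 2) :
    piPerc d p 2 (genDisjOcc ![event (eq 1) u v, event (eq 1) v t, event (ge 2) t u] c) ≤
      blockAiota (Letters.perc d p) ι 0 1 u u v t := by
  have he : v - u = stepVec ι := by rw [hv, add_sub_cancel_left]
  rw [blockAiota, ofBase, blockAiota₀_zero_one, sub_self, kd_self, kdc_of_ne (sub_ne_zero.2 htu), one_mul,
    one_mul, ← he, kd_self, one_mul]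
  have h := piPerc_genDisjOcc_le_T p (eq 1) (eq 1) (ge 2) u v t u c
  rw [sub_self] at h
  exact h.trans le_self_add

/-- **Row `(0,1)`, sub-row `x ≠ e`, as a four-line letter on two levels**: for `w = u`, `w′ ≠ v` the lines
`{u ←1̲→ v}`, `{v ←1→ w′}`, `{w′ ←1̲→ t}`, `{t ←1→ u}` (`t ≠ u`) are bounded by `A^{ι,0,1}(u,u,w′,t)` (its
summand `S_{1̲,1,1̲,1}(e,x,y,0)`).
[cite: FitznerVanDerHofstad2017, §6.1 "Case a = 0" (arXiv:1506.07977v2 p. 58); App. B row a = 0, b = 1 (p. 75)] -/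
theorem piPerc_midF1_zero_one_ne_le_blockAiota {ι : Fin d × Bool} {u v w' t : Site d} (hv : v = u + stepVec ι)
    (htu : t ≠ u) (c : Fin 4 → Fin 2) :
    piPerc d p 2 (genDisjOcc ![event (eq 1) u v, event (ge 1) v w', event (eq 1) w' t, event (ge 1) t u] c) ≤
      blockAiota (Letters.perc d p) ι 0 1 u u w' t := by
  have he : v - u = stepVec ι := by rw [hv, add_sub_cancel_left]
  rw [blockAiota, ofBase, blockAiota₀_zero_one, sub_self, kd_self, kdc_of_ne (sub_ne_zero.2 htu), one_mul,
    one_mul, ← he]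
  have h := piPerc_genDisjOcc_le_S p (eq 1) (ge 1) (eq 1) (ge 1) u v w' t u c
  rw [sub_self] at h
  exact h.trans le_add_self

/-- **Row `(1,1)` as a four-line letter on two levels**: for `(u,w)` a lattice bond the lines `{u ←1̲→ v}`,
`{v ↔ w′}`, `{w′ ←1̲→ t}`, `{t ↔ w}` are bounded by `A^{ι,1,1}(u,w,w′,t)`.
[cite: FitznerVanDerHofstad2017, §6.1 "Case a = 1" / "b = 1" (arXiv:1506.07977v2 p. 59); App. B row a = 1, b = 1 (p. 75)] -/
theorem piPerc_midF1_one_one_le_blockAiota {ι κ' : Fin d × Bool} {u v w w' t : Site d} (hv : v = u + stepVec ι)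
    (hw : w = u + stepVec κ') (c : Fin 4 → Fin 2) :
    piPerc d p 2 (genDisjOcc ![event (eq 1) u v, event (ge 0) v w', event (eq 1) w' t, event (ge 0) t w] c) ≤
      blockAiota (Letters.perc d p) ι 1 1 u w w' t := by
  have he : v - u = stepVec ι := by rw [hv, add_sub_cancel_left]
  have hk : w - u = stepVec κ' := by rw [hw, add_sub_cancel_left]
  rw [blockAiota, ofBase, blockAiota₀_one_one, hk, twoDD_stepVec, one_mul, ← hk, ← he]
  exact piPerc_genDisjOcc_le_S p (eq 1) (ge 0) (eq 1) (ge 0) u v w' t w c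

/-- **Row `(2,1)` as a four-line letter on two levels**: the lines `{u ←1̲→ v}`, `{v ↔ w′}`, `{w′ ←1̲→ t}`,
`{t ↔ w}` are bounded by `A^{ι,2,1}(u,w,w′,t)`.
[cite: FitznerVanDerHofstad2017, §6.1 "Case a ≥ 2" / "b = 1" (arXiv:1506.07977v2 p. 59); App. B row a ≥ 2, b = 1 (p. 75)] -/
theorem piPerc_midF1_two_one_le_blockAiota {ι : Fin d × Bool} {u v w w' t : Site d} (hv : v = u + stepVec ι)
    (c : Fin 4 → Fin 2) :
    piPerc d p 2 (genDisjOcc ![event (eq 1) u v, event (ge 0) v w', event (eq 1) w' t, event (ge 0) t w] c) ≤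
      blockAiota (Letters.perc d p) ι 2 1 u w w' t := by
  have he : v - u = stepVec ι := by rw [hv, add_sub_cancel_left]
  rw [blockAiota, ofBase, blockAiota₀_two_one, ← he]
  exact piPerc_genDisjOcc_le_S p (eq 1) (ge 0) (eq 1) (ge 0) u v w' t w c

/-- **Row `(0,2)` as a four-line letter on two levels**: for `w = u` (then `w′, t ≠ u` by vacancy) the lines
`{u ←1̲→ v}`, `{v ↔ w′}`, `{w′ ←2→ t}`, `{t ←1→ u}` are bounded by `A^{ι,0,2}(u,u,w′,t)`.
[cite: FitznerVanDerHofstad2017, §6.1 "Case a = 0" / "b ≥ 2" (arXiv:1506.07977v2 pp. 58–59); App. B row a = 0, b ≥ 2 (p. 75)] -/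
theorem piPerc_midF1_zero_two_le_blockAiota {ι : Fin d × Bool} {u v w' t : Site d} (hv : v = u + stepVec ι)
    (htu : t ≠ u) (hwu : w' ≠ u) (c : Fin 4 → Fin 2) :
    piPerc d p 2 (genDisjOcc ![event (eq 1) u v, event (ge 0) v w', event (ge 2) w' t, event (ge 1) t u] c) ≤
      blockAiota (Letters.perc d p) ι 0 2 u u w' t := by
  have he : v - u = stepVec ι := by rw [hv, add_sub_cancel_left]
  rw [blockAiota, ofBase, blockAiota₀_zero_two, sub_self, kd_self, kdc_of_ne (sub_ne_zero.2 htu),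
    kdc_of_ne (sub_ne_zero.2 hwu), one_mul, one_mul, one_mul, ← he]
  have h := piPerc_genDisjOcc_le_S p (eq 1) (ge 0) (ge 2) (ge 1) u v w' t u c
  rw [sub_self] at h
  exact h

/-- **Row `(1,2)` as a four-line letter on two levels**: for `(u,w)` a lattice bond the lines `{u ←1̲→ v}`,
`{v ↔ w′}`, `{w′ ←2→ t}`, `{t ↔ w}` are bounded by `A^{ι,1,2}(u,w,w′,t)`.
[cite: FitznerVanDerHofstad2017, §6.1 "Case a = 1" / "b ≥ 2" (arXiv:1506.07977v2 p. 59); App. B row a = 1, b ≥ 2 (p. 75)] -/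
theorem piPerc_midF1_one_two_le_blockAiota {ι κ' : Fin d × Bool} {u v w w' t : Site d} (hv : v = u + stepVec ι)
    (hw : w = u + stepVec κ') (c : Fin 4 → Fin 2) :
    piPerc d p 2 (genDisjOcc ![event (eq 1) u v, event (ge 0) v w', event (ge 2) w' t, event (ge 0) t w] c) ≤
      blockAiota (Letters.perc d p) ι 1 2 u w w' t := by
  have he : v - u = stepVec ι := by rw [hv, add_sub_cancel_left]
  have hk : w - u = stepVec κ' := by rw [hw, add_sub_cancel_left]
  rw [blockAiota, ofBase, blockAiota₀_one_two, hk, twoDD_stepVec, one_mul, ← hk, ← he]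
  exact piPerc_genDisjOcc_le_S p (eq 1) (ge 0) (ge 2) (ge 0) u v w' t w c

/-- **Row `(2,2)` as a four-line letter on two levels**: the lines `{u ←1̲→ v}`, `{v ↔ w′}`, `{w′ ←2→ t}`,
`{t ↔ w}` are bounded by `A^{ι,2,2}(u,w,w′,t)`.
[cite: FitznerVanDerHofstad2017, §6.1 "Cases a ≥ 1 and b ≥ 1" (arXiv:1506.07977v2 p. 59); App. B row a ≥ 2, b ≥ 2 (p. 75)] -/
theorem piPerc_midF1_two_two_le_blockAiota {ι : Fin d × Bool} {u v w w' t : Site d} (hv : v = u + stepVec ι)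
    (c : Fin 4 → Fin 2) :
    piPerc d p 2 (genDisjOcc ![event (eq 1) u v, event (ge 0) v w', event (ge 2) w' t, event (ge 0) t w] c) ≤
      blockAiota (Letters.perc d p) ι 2 2 u w w' t := by
  have he : v - u = stepVec ι := by rw [hv, add_sub_cancel_left]
  rw [blockAiota, ofBase, blockAiota₀_two_two, ← he]
  exact piPerc_genDisjOcc_le_S p (eq 1) (ge 0) (ge 2) (ge 0) u v w' t w c

end Rows

/-! ### B. A middle level of kind `midE` and the facts of the regime `t_k = u_{k+1}` (`F′`) in closed form -/

section MidE

variable (M : ℕ) (x : Site d) (b : Fin (M + 2) → Site d × Site d) (w t z : Fin (M + 2) → Site d)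
  (a : Fin (M + 2) → Fin 3 ⊕ Unit) (τ : Fin (M + 1) → Bool × Fin 3)

/-- The middle level `k + 1` of kind `midE` (variants `F′ ∪ F″`) over an open exit, in closed form.
[cite: FitznerVanDerHofstad2017, (4.59)–(4.60) (arXiv:1506.07977v2 p. 41)] -/
theorem pieceViews_midE (i : Fin (M + 1)) (hσ : (τ i).1 = true) {a' : Fin 3} (ha' : a i.succ = Sum.inl a') :
    pieceViews M x b w t z a τ i.castSucc.succ =
      ⟨.midE, (b i.castSucc).1, (b i.castSucc).2, t i.castSucc, z i.castSucc, (b i.succ).1, (b i.succ).2,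
        w i.succ, z i.succ, bondsAt {(b i.castSucc).1} ∪ {s((b i.succ).1, (b i.succ).2)}⟩ := by
  rw [pieceViews_mid, ha', hσ]; rfl

/-- The lines of a `midE` level `k + 1`: `v → w′`, `w′ → t`, `t → z`, `t → u′`, `z → u′`, `w′ → z′` ((4.59)–(4.60)).
[cite: FitznerVanDerHofstad2017, (4.59)–(4.60) (arXiv:1506.07977v2 p. 41)] -/
theorem pieceViews_midE_line (i : Fin (M + 1)) (hσ : (τ i).1 = true) {a' : Fin 3} (ha' : a i.succ = Sum.inl a')
    (j : Fin 6) :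
    (pieceViews M x b w t z a τ i.castSucc.succ).line j =
      ![((b i.castSucc).2, w i.succ), (w i.succ, t i.castSucc), (t i.castSucc, z i.castSucc),
        (t i.castSucc, (b i.succ).1), (z i.castSucc, (b i.succ).1), (w i.succ, z i.succ)] j := by
  rw [pieceViews_midE M x b w t z a τ i hσ ha']; rfl

/-- At a junction `k ≤ M` over a `midE` level `k + 1`, the upper line `up j` is active iff `j ≠ 5`.
[cite: FitznerVanDerHofstad2017, (4.59)–(4.60) (arXiv:1506.07977v2 p. 41)] -/
theorem jMidE_act_up_iff (i : Fin (M + 1)) (hσ : (τ i).1 = true) {a' : Fin 3} (ha' : a i.succ = Sum.inl a')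
    (uB uT : Bool) (j : Fin 6) : (jctx M x b w t z a τ i.castSucc).Act uB uT (.up j) ↔ j ≠ 5 := by
  rw [jMid_act_up_iff, ha', hσ]
  have hj : ¬ IsTriv (midKind (Sum.inl a' : Fin 3 ⊕ Unit).isRight true) j := by
    show ¬ (6 ≤ (j : ℕ))
    have := j.isLt
    omega
  exact ⟨fun h => h.1, fun h => ⟨h, hj⟩⟩

/-- **The grouping `glMidS1` obeys the (4.65) rule over a `midE` level too**: its only cross-level letter joins
lower lines with the ENTRY slots `0, 1` of level `k + 1` (a `midE` level has the three entry slots `0, 1, 2`).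
[cite: FitznerVanDerHofstad2017, §4.4 (4.65) and the sentence after it (arXiv:1506.07977v2 p. 43)] -/
theorem glMidS1_entry_midE (i : Fin (M + 1)) (hσ : (τ i).1 = true) {a' : Fin 3} (ha' : a i.succ = Sum.inl a')
    (j j' : Fin 6) (hg : glMidS1 (.lo j) = glMidS1 (.up j')) :
    IsEntry (pieceViews M x b w t z a τ i.castSucc.succ).kd j' := by
  rw [pieceViews_mid_kd, ha', hσ]
  show (j' : ℕ) < 3
  fin_cases j' <;> simp [glMidS1] at hg ⊢

end MidE

section MidEFacts

variable {M : ℕ} {x : Site d} {b : Fin (M + 2) → Site d × Site d} {w t z : Fin (M + 2) → Site d}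
  {a : Fin (M + 2) → Fin 3 ⊕ Unit} {c : Fin 3 ⊕ Unit} {τ : Fin (M + 1) → Bool × Fin 3}
  {ω : Fin (M + 3) → BondConfig (Site d)} {K₀ : Fin (M + 3) → Fin 6 → Set (Sym2 (Site d))}

namespace JFacts

/-- The witnesses of a `midE` level `k + 1` witness its five lines `v → w′`, `w′ → t`, `t → z`, `t → u′`, `z → u′`.
[cite: FitznerVanDerHofstad2017, (4.59)–(4.60) (arXiv:1506.07977v2 p. 41)] -/
theorem conn_midE (h : JFacts M x b w t z a c τ ω K₀) (i : Fin (M + 1)) (hσ : (τ i).1 = true) {a' : Fin 3}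
    (ha' : a i.succ = Sum.inl a') :
    K₀ i.castSucc.succ 0 ∈ (openConn (b i.castSucc).2 (w i.succ) : Set (BondConfig (Site d))) ∧
    K₀ i.castSucc.succ 1 ∈ (openConn (w i.succ) (t i.castSucc) : Set (BondConfig (Site d))) ∧
    K₀ i.castSucc.succ 2 ∈ (openConn (t i.castSucc) (z i.castSucc) : Set (BondConfig (Site d))) ∧
    K₀ i.castSucc.succ 3 ∈ (openConn (t i.castSucc) (b i.succ).1 : Set (BondConfig (Site d))) ∧
    K₀ i.castSucc.succ 4 ∈ (openConn (z i.castSucc) (b i.succ).1 : Set (BondConfig (Site d))) := by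
  have h0 := h.conn i.castSucc.succ 0
  have h1 := h.conn i.castSucc.succ 1
  have h2 := h.conn i.castSucc.succ 2
  have h3 := h.conn i.castSucc.succ 3
  have h4 := h.conn i.castSucc.succ 4
  rw [pieceViews_midE_line M x b w t z a τ i hσ ha'] at h0 h1 h2 h3 h4
  exact ⟨h0, h1, h2, h3, h4⟩

/-- The canonical clause of a `midE` level `k + 1`: `(z_k = u_{k+1} ↔ t_k = u_{k+1})` and `(w_{k+1} ≠ t_k ∨
t_k = u_{k+1})`. [cite: FitznerVanDerHofstad2017, (4.59)–(4.60) "{z_i = b̲_i = t_i}", "{z_i ≠ b̲_i} ∩ {w_i ≠ t_i}" (arXiv:1506.07977v2 p. 41)] -/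
theorem canon_midE (h : JFacts M x b w t z a c τ ω K₀) (i : Fin (M + 1)) (hσ : (τ i).1 = true) {a' : Fin 3}
    (ha' : a i.succ = Sum.inl a') :
    (z i.castSucc = (b i.succ).1 ↔ t i.castSucc = (b i.succ).1) ∧ (w i.succ ≠ t i.castSucc ∨ t i.castSucc = (b i.succ).1) := by
  have hc := (h.level i.castSucc.succ).1
  rw [pieceViews_midE M x b w t z a τ i hσ ha'] at hc
  exact hc

/-- The vacancy clause of a `midE` level `k + 1`: `u_k ∉ {t_k, w_{k+1}, z_k, u_{k+1}, z_{k+1}}`.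
[cite: FitznerVanDerHofstad2017, (4.59)–(4.60) "b̲_{i-1} ∉ …" (arXiv:1506.07977v2 p. 41)] -/
theorem vac_midE (h : JFacts M x b w t z a c τ ω K₀) (i : Fin (M + 1)) (hσ : (τ i).1 = true) {a' : Fin 3}
    (ha' : a i.succ = Sum.inl a') :
    (b i.castSucc).1 ∉ ({t i.castSucc, w i.succ, z i.castSucc, (b i.succ).1, z i.succ} : Set (Site d)) := by
  have hv := (h.level i.castSucc.succ).2.1
  rw [pieceViews_midE M x b w t z a τ i hσ ha'] at hv
  exact hv

/-- **In the regime `t_k = u_{k+1}` of a `midE` level (`F′`) the last sausage is trivial**: `z_k = t_k`.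
[cite: FitznerVanDerHofstad2017, (4.59) "F′: {z_i = b̲_i = t_i}" (arXiv:1506.07977v2 p. 41)] -/
theorem z_eq_t_of_midE_of_t_eq (h : JFacts M x b w t z a c τ ω K₀) (i : Fin (M + 1)) (hσ : (τ i).1 = true)
    {a' : Fin 3} (ha' : a i.succ = Sum.inl a') (hty : t i.castSucc = (b i.succ).1) :
    z i.castSucc = t i.castSucc :=
  (((h.canon_midE i hσ ha').1).2 hty).trans hty.symm

/-- **Normal form (10) of the joint witnesses on `F′`, exit class `1`**: the witness of slot `1` (`w′ → t = u′`) IS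
the open bond `{w′, u′}`. [cite: FitznerVanDerHofstad2017, §6.1 proof of Lemma 5.2, Cases a = 1 / b = 1, "we include the information that … are neighbors" (arXiv:1506.07977v2 pp. 58–59)] -/
theorem wit_one_midF1 (h : JFacts M x b w t z a c τ ω K₀) (i : Fin (M + 1)) (hσ : (τ i).1 = true)
    (ha' : a i.succ = Sum.inl 1) (hty : t i.castSucc = (b i.succ).1) :
    K₀ i.castSucc.succ 1 = {s(w i.succ, (b i.succ).1)} := by
  have h1 := h.exitClass_one i.succ ha'
  have hk : (pieceViews M x b w t z a τ i.castSucc.succ).kd = .midE := by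
    rw [pieceViews_midE M x b w t z a τ i hσ ha']
  have hw := h.conds.wyNF_midE i.castSucc.succ hk
  rw [pieceViews_midE M x b w t z a τ i hσ ha'] at hw
  refine hw hty h1.1.symm ?_
  rw [Sym2.eq_swap, Fin.succ_castSucc]
  exact h1.2.1

end JFacts

end MidEFacts

/-! ### C. The letter of term 2 and its two-level readings -/

section Letter

variable (p : unitInterval) (M : ℕ) (x : Site d) (b : Fin (M + 2) → Site d × Site d) (w t z : Fin (M + 2) → Site d)
  (a : Fin (M + 2) → Fin 3 ⊕ Unit) (τ : Fin (M + 1) → Bool × Fin 3)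

/-- The events of term 2 at a middle junction of variant `F′`: bond `EB`, entry lines `E0` (`v → w′`), `E1`
(`w′ → t`), the exit line `X5` of level `k`; the three loop slots `2, 3, 4` of the `midE` level and all other
local lines carry the sure event. [cite: FitznerVanDerHofstad2017, §5.1 (5.4) second term (arXiv:1506.07977v2 p. 48); (4.59) (p. 41)] -/
def midF1Ev (EB E0 E1 X5 : Set (BondConfig (Site d))) : JIdx → Set (BondConfig (Site d)) :=
  midEv EB E0 E1 Set.univ Set.univ Set.univ X5

/-- **Four-line reading of the term-2 letter**: bond (level `k`), `v → w′`, `w′ → t` (level `k + 1`), exit line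
(level `k`). [cite: FitznerVanDerHofstad2017, §4.2 (4.18) (arXiv:1506.07977v2 p. 35); §6.1 (6.4) (p. 58)] -/
theorem junF_midF1_le₄ (i i₀ : Fin (M + 1)) (hk : i₀.succ = i.castSucc) (hσ : (τ i).1 = true) {a₀ a' : Fin 3}
    (ha : a i.castSucc = Sum.inl a₀) (ha' : a i.succ = Sum.inl a') (EB E0 E1 X5 : Set (BondConfig (Site d))) :
    junF p M x b w t z a τ i.castSucc glMidS1 true false (midF1Ev EB E0 E1 X5) .xb ≤
      piPerc d p 2 (genDisjOcc ![EB, E0, E1, X5] ![0, 1, 1, 0]) := by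
  refine junF_le_of_lines p M x b w t z a τ i.castSucc glMidS1 true false _ JIdx.xb
    ![JIdx.xb, .up 0, .up 1, .lo 5] (by decide) (fun m => ?_) ![0, 1, 1, 0] (fun m => by fin_cases m <;> rfl)
    ![EB, E0, E1, X5] (by funext m; fin_cases m <;> rfl)
  fin_cases m
  · exact ⟨rfl, rfl⟩
  · exact ⟨(jMidE_act_up_iff M x b w t z a τ i hσ ha' true false 0).2 (by decide), rfl⟩
  · exact ⟨(jMidE_act_up_iff M x b w t z a τ i hσ ha' true false 1).2 (by decide), rfl⟩
  · exact ⟨(jMidOpen_act_lo_iff M x b w t z a τ i i₀ hk ha true false 5).2 rfl, rfl⟩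

/-- **Three-line reading, slot `1` dropped** (rows `(·,0)`: `w′ = t`, the class-`a′` leg is trivial).
[cite: FitznerVanDerHofstad2017, §4.2 (4.18) (arXiv:1506.07977v2 p. 35); §6.1 (6.4) (p. 58)] -/
theorem junF_midF1_le₃ (i i₀ : Fin (M + 1)) (hk : i₀.succ = i.castSucc) (hσ : (τ i).1 = true) {a₀ a' : Fin 3}
    (ha : a i.castSucc = Sum.inl a₀) (ha' : a i.succ = Sum.inl a') (EB E0 E1 X5 : Set (BondConfig (Site d))) :
    junF p M x b w t z a τ i.castSucc glMidS1 true false (midF1Ev EB E0 E1 X5) .xb ≤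
      piPerc d p 2 (genDisjOcc ![EB, E0, X5] ![0, 1, 0]) := by
  refine junF_le_of_lines p M x b w t z a τ i.castSucc glMidS1 true false _ JIdx.xb
    ![JIdx.xb, .up 0, .lo 5] (by decide) (fun m => ?_) ![0, 1, 0] (fun m => by fin_cases m <;> rfl)
    ![EB, E0, X5] (by funext m; fin_cases m <;> rfl)
  fin_cases m
  · exact ⟨rfl, rfl⟩
  · exact ⟨(jMidE_act_up_iff M x b w t z a τ i hσ ha' true false 0).2 (by decide), rfl⟩
  · exact ⟨(jMidOpen_act_lo_iff M x b w t z a τ i i₀ hk ha true false 5).2 rfl, rfl⟩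

/-- **Three-line reading, slot `0` dropped** (sub-row `x = e` of row `(0,1)`: `w′ = v`, the entry line is trivial).
[cite: FitznerVanDerHofstad2017, §4.2 (4.18) (arXiv:1506.07977v2 p. 35); §6.1 (6.4) (p. 58)] -/
theorem junF_midF1_le₃' (i i₀ : Fin (M + 1)) (hk : i₀.succ = i.castSucc) (hσ : (τ i).1 = true) {a₀ a' : Fin 3}
    (ha : a i.castSucc = Sum.inl a₀) (ha' : a i.succ = Sum.inl a') (EB E0 E1 X5 : Set (BondConfig (Site d))) :
    junF p M x b w t z a τ i.castSucc glMidS1 true false (midF1Ev EB E0 E1 X5) .xb ≤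
      piPerc d p 2 (genDisjOcc ![EB, E1, X5] ![0, 1, 0]) := by
  refine junF_le_of_lines p M x b w t z a τ i.castSucc glMidS1 true false _ JIdx.xb
    ![JIdx.xb, .up 1, .lo 5] (by decide) (fun m => ?_) ![0, 1, 0] (fun m => by fin_cases m <;> rfl)
    ![EB, E1, X5] (by funext m; fin_cases m <;> rfl)
  fin_cases m
  · exact ⟨rfl, rfl⟩
  · exact ⟨(jMidE_act_up_iff M x b w t z a τ i hσ ha' true false 1).2 (by decide), rfl⟩
  · exact ⟨(jMidOpen_act_lo_iff M x b w t z a τ i i₀ hk ha true false 5).2 rfl, rfl⟩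

variable (c : Fin 3 ⊕ Unit)

/-- **The core of every term-2 package**: at a middle junction over a `midE` level, finitary events `E0 ⊇` the
witness of `v → w′`, `E1 ⊇` the witness of `w′ → t`, `X5 ⊇` the exit witness of level `k` (on the piece), and a
bound of the single genuine letter `xb` = {bond, `v → w′`, `w′ → t`, exit} by the target give a package; the loop
slots `2, 3, 4` form letters bounded by `1`.
[cite: FitznerVanDerHofstad2017, §6.1 (6.4) (arXiv:1506.07977v2 p. 58); §4.4 (4.57)–(4.61), (4.65) (pp. 41, 43)] -/
theorem nonempty_jPkg_midF1_core (i i₀ : Fin (M + 1)) (hk : i₀.succ = i.castSucc) (κ : Fin d × Bool)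
    (hb : (b i.castSucc).2 = (b i.castSucc).1 + stepVec κ) (hσ : (τ i).1 = true) {a₀ a' : Fin 3}
    (ha : a i.castSucc = Sum.inl a₀) (ha' : a i.succ = Sum.inl a') (E0 E1 X5 : Set (BondConfig (Site d)))
    (h0 : IsFinitary E0) (h1 : IsFinitary E1) (h5 : IsFinitary X5)
    (hmem : ∀ ω K₀, JFacts M x b w t z a c τ ω K₀ →
      K₀ i.castSucc.succ 0 ∈ E0 ∧ K₀ i.castSucc.succ 1 ∈ E1 ∧ K₀ i.castSucc.castSucc 5 ∈ X5)
    {tgt : ℝ≥0∞}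
    (hrow : junF p M x b w t z a τ i.castSucc glMidS1 true false
      (midF1Ev (event (eq 1) (b i.castSucc).1 (b i.castSucc).2) E0 E1 X5) .xb ≤ tgt) :
    Nonempty (JPkg p (jctx M x b w t z a τ i.castSucc) (JFacts M x b w t z a c τ) tgt) := by
  have huv : (b i.castSucc).1 ≠ (b i.castSucc).2 := by
    rw [hb]; exact (zdGraph_adj_iff_stepVec _ _ |>.2 ⟨κ, rfl⟩).ne
  refine nonempty_jPkg_of_joint p i.castSucc glMidS1 true
    (midF1Ev (event (eq 1) (b i.castSucc).1 (b i.castSucc).2) E0 E1 X5)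
    (isFinitary_midEv _ _ _ _ _ _ _ (isFinitary_event _ _ _) h0 h1 isFinitary_univ isFinitary_univ
      isFinitary_univ h5)
    (fun _ => by rw [midF1Ev, midEv_xb]; exact singleton_mem_event_eq_one huv)
    (fun j j' _ _ hg => glMidS1_entry_midE M x b w t z a τ i hσ ha' j j' hg)
    (fun ω K₀ hF => ⟨fun j hj => ?_, fun j hj => ?_⟩) ?_
  · -- the exit witness of level `k`
    obtain rfl := (jMidOpen_act_lo_iff M x b w t z a τ i i₀ hk ha true false j).1 hj
    rw [midF1Ev, midEv_lo_five]
    exact (hmem ω K₀ hF).2.2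
  · -- the witnesses of level `k + 1`
    have hj5 : j ≠ 5 := (jMidE_act_up_iff M x b w t z a τ i hσ ha' true false j).1 hj
    exact mem_midEv_up _ _ _ _ _ _ _ (hmem ω K₀ hF).1 (hmem ω K₀ hF).2.1 (Set.mem_univ _) (Set.mem_univ _)
      (Set.mem_univ _) j hj5
  · -- one genuine letter
    refine (prod_junF_le₂ p M x b w t z a τ i.castSucc glMidS1 true false _
      (show JIdx.xb ≠ JIdx.up 2 by decide)).trans ?_
    refine (mul_le_mul' hrow (junF_le_one p M x b w t z a τ i.castSucc glMidS1 true false _ _)).trans ?_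
    rw [mul_one]

end Letter

/-! ### D. The packages of the cells `(a, a′)`, variant `F′` (term 2 at the end vertex) -/

section Packages

variable (p : unitInterval) (M : ℕ) (x : Site d) (b : Fin (M + 2) → Site d × Site d) (w t z : Fin (M + 2) → Site d)
  (a : Fin (M + 2) → Fin 3 ⊕ Unit) (c : Fin 3 ⊕ Unit) (τ : Fin (M + 1) → Bool × Fin 3)

/-- VACUOUS CELL of the regime: a `midE` level `k + 1` handed with `t_k = u_{k+1}` but `z_k ≠ t_k` is empty
(canonical clause of `F′`), so it carries a package with any target.
[cite: FitznerVanDerHofstad2017, (4.59) "F′: {z_i = b̲_i = t_i}" (arXiv:1506.07977v2 p. 41)] -/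
theorem nonempty_jPkg_of_midE_t_eq_z_ne (k : Fin (M + 2)) (i : Fin (M + 1)) (hσ : (τ i).1 = true) {a' : Fin 3}
    (ha' : a i.succ = Sum.inl a') (hty : t i.castSucc = (b i.succ).1) (hzt : z i.castSucc ≠ t i.castSucc)
    (tgt : ℝ≥0∞) : Nonempty (JPkg p (jctx M x b w t z a τ k) (JFacts M x b w t z a c τ) tgt) :=
  ⟨JPkg.vacuous p _ _ (fun _ _ hF => hzt (hF.z_eq_t_of_midE_of_t_eq i hσ ha' hty)) tgt⟩

/-- The PARAMETER FACTS of a non-empty `F′` piece at junction `k`, read off `JFacts`: `z = t`, `u ∉ {t, w′}`,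
`b̄ ≠ t`, and the exit classes of both levels versus the parameters. [cite: FitznerVanDerHofstad2017, (4.59), (4.64) and §6.1 "Case a, b" (arXiv:1506.07977v2 pp. 41–42, 58–59)] -/
theorem midF1_facts {ω : Fin (M + 3) → BondConfig (Site d)} {K₀ : Fin (M + 3) → Fin 6 → Set (Sym2 (Site d))}
    (hF : JFacts M x b w t z a c τ ω K₀) (i i₀ : Fin (M + 1)) (hk : i₀.succ = i.castSucc) (hσ : (τ i).1 = true)
    {a₀ a' : Fin 3} (ha : a i.castSucc = Sum.inl a₀) (ha' : a i.succ = Sum.inl a')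
    (hty : t i.castSucc = (b i.succ).1) :
    z i.castSucc = t i.castSucc ∧ (b i.castSucc).1 ≠ t i.castSucc ∧ (b i.castSucc).1 ≠ w i.succ ∧
      (b i.castSucc).2 ≠ t i.castSucc ∧ (a₀ = 0 → w i.castSucc = (b i.castSucc).1) ∧
      (a₀ = 1 → (zdGraph d).Adj (b i.castSucc).1 (w i.castSucc)) ∧ (a' = 0 → w i.succ = t i.castSucc) ∧
      (a' ≠ 0 → w i.succ ≠ t i.castSucc) ∧ (a' = 1 → (zdGraph d).Adj (w i.succ) (t i.castSucc)) ∧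
      (a' = 2 → s(w i.succ, t i.castSucc) ∉ ω i.castSucc.succ) := by
  have hzt := hF.z_eq_t_of_midE_of_t_eq i hσ ha' hty
  have hv := hF.vac_midE i hσ ha'
  refine ⟨hzt, fun h => hv (by simp [h]), fun h => hv (by simp [h]), ?_, ?_, ?_, ?_, ?_, ?_, ?_⟩
  · rw [← hzt]; exact hF.v_ne_z_of_open i i₀ hk ha
  · intro h0; exact hF.w_eq_of_exitClass_zero i.castSucc (ha.trans (by rw [h0]))
  · intro h1; exact (hF.exitClass_one i.castSucc (ha.trans (by rw [h1]))).2.2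
  · intro h0; rw [hty]; exact hF.w_eq_of_exitClass_zero i.succ (ha'.trans (by rw [h0]))
  · intro h0; rw [hty]; exact (hF.u_ne_w_of_exitClass_ne_zero i.succ ha' h0).symm
  · intro h1; rw [hty]; exact ((hF.exitClass_one i.succ (ha'.trans (by rw [h1]))).2.2).symm
  · intro h2
    have h := (hF.exitClass_two i.succ (ha'.trans (by rw [h2]))).2
    rw [hty, Sym2.eq_swap, Fin.succ_castSucc]
    exact h

/-- **Cells `(a, 0)`, `a ∈ {0,1,2}`, variant `F′`, of a middle junction `k = i₀ + 1 ≤ M`, against the PRIMED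
family** (row `(0,0)` in the §6.1 reading `T_{1̲,1,1}`; rows `(1,0)`, `(2,0)` as in App. B): a package with target
`A'^{κ,a,0}(u_k, w_k, w_{k+1}, t_k)` = the second term of (5.4) at its internal vertex `t_k = u_{k+1}`.  Exit class
`0` of level `k + 1` identifies `w_{k+1} = u_{k+1} = t_k`, so the letter is the triangle bond · `{b̄ ←1→ w′}` ·
exit line of level `k` (`w′ = z_k ≠ b̄_k`).
[cite: FitznerVanDerHofstad2017, §6.1 (6.4), "Case a = 0 and b = 0", "Case a = 1", "Case a ≥ 2" (arXiv:1506.07977v2 pp. 58–59); §5.1 (5.4) (p. 48); App. B (p. 75)] -/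
theorem nonempty_jPkg_midF1_zero' (i i₀ : Fin (M + 1)) (hk : i₀.succ = i.castSucc) (κ : Fin d × Bool)
    (hb : (b i.castSucc).2 = (b i.castSucc).1 + stepVec κ) (hσ : (τ i).1 = true) (a₀ : Fin 3)
    (ha : a i.castSucc = Sum.inl a₀) (ha' : a i.succ = Sum.inl 0) (hty : t i.castSucc = (b i.succ).1) :
    Nonempty (JPkg p (jctx M x b w t z a τ i.castSucc) (JFacts M x b w t z a c τ)
      (blockAiota' (Letters.perc d p) κ a₀ 0 (b i.castSucc).1 (w i.castSucc) (w i.succ) (t i.castSucc))) := by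
  -- degenerate parameters: the piece is empty
  by_cases hP : z i.castSucc = t i.castSucc ∧ (b i.castSucc).1 ≠ t i.castSucc ∧ (b i.castSucc).2 ≠ t i.castSucc ∧
      (a₀ = 0 → w i.castSucc = (b i.castSucc).1) ∧ (a₀ = 1 → (zdGraph d).Adj (b i.castSucc).1 (w i.castSucc)) ∧
      w i.succ = t i.castSucc
  swap
  · refine ⟨JPkg.vacuous p _ _ (fun ω K₀ hF => hP ?_) _⟩
    obtain ⟨hzt, hut, -, hvt, hw0, hw1, hw', -⟩ := midF1_facts M x b w t z a c τ hF i i₀ hk hσ ha ha' hty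
    exact ⟨hzt, hut, hvt, hw0, hw1, hw' rfl⟩
  obtain ⟨hzt, hut, hvt, hw0, hw1, hw'⟩ := hP
  rw [hw']
  refine nonempty_jPkg_midF1_core p M x b w t z a τ c i i₀ hk κ hb hσ ha ha'
    (event (ge 1) (b i.castSucc).2 (t i.castSucc)) Set.univ
    (endX a₀ (b i.castSucc).1 (w i.castSucc) (t i.castSucc))
    (isFinitary_event _ _ _) isFinitary_univ (isFinitary_endX _ _ _ _) (fun ω K₀ hF => ⟨?_, Set.mem_univ _, ?_⟩) ?_
  · -- entry line `b̄ → w′ = t`, non-trivial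
    obtain ⟨h0, -⟩ := hF.conn_midE i hσ ha'
    rw [hw'] at h0
    rw [event_ge]; exact mem_openConnGe_one_of_ne h0 hvt
  · -- the exit witness of level `k`: `w_k → z_k = t`
    have h5 := hF.conn_exit i i₀ hk ha
    rw [hzt] at h5
    unfold endX
    split_ifs with h0
    · rw [hw0 h0] at h5
      rw [event_comm, event_ge]
      exact mem_openConnGe_one_of_ne h5 hut
    · rw [event_comm, event_ge]
      exact mem_openConnGe_zero_of_mem h5
  · -- the letter
    refine (junF_midF1_le₃ p M x b w t z a τ i i₀ hk hσ ha ha' _ _ _ _).trans ?_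
    unfold endX
    split_ifs with h0
    · subst h0
      rw [hw0 rfl]
      exact piPerc_midF1_zero_zero_le_blockAiota' p hb hvt.symm (fun h => hut h.symm) _
    · obtain h1 | h2 : a₀ = 1 ∨ a₀ = 2 := by
        fin_cases a₀
        · exact absurd rfl h0
        · exact Or.inl rfl
        · exact Or.inr rfl
      · subst h1
        obtain ⟨κ', hκ'⟩ := (zdGraph_adj_iff_stepVec _ _).1 (hw1 rfl)
        rw [blockAiota'_of_ne _ _ (by decide)]
        exact piPerc_midF1_one_zero_le_blockAiota p hb hκ' (fun h => hut h.symm) _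
      · subst h2
        rw [blockAiota'_of_ne _ _ (by decide)]
        exact piPerc_midF1_two_zero_le_blockAiota p hb _

/-- **Cells `(a, 1)`, `a ∈ {0,1,2}`, variant `F′`**: a package with target `A^{κ,a,1}(u_k, w_k, w_{k+1}, t_k)`.
Exit class `1` of level `k + 1` makes `{w_{k+1}, u_{k+1} = t_k}` an open bond, which IS the witness of the line
`w′ → t` (normal form (10)); row `(0,1)` splits into `w′ = b̄` (triangle, exit line of length `≥ 2` by parity) and
`w′ ≠ b̄` (square).
[cite: FitznerVanDerHofstad2017, §6.1 (6.4), "Case a = 0", "Case a = 1", "b = 1" (arXiv:1506.07977v2 pp. 58–59); §5.1 (5.4) (p. 48); App. B (p. 75)] -/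
theorem nonempty_jPkg_midF1_one (i i₀ : Fin (M + 1)) (hk : i₀.succ = i.castSucc) (κ : Fin d × Bool)
    (hb : (b i.castSucc).2 = (b i.castSucc).1 + stepVec κ) (hσ : (τ i).1 = true) (a₀ : Fin 3)
    (ha : a i.castSucc = Sum.inl a₀) (ha' : a i.succ = Sum.inl 1) (hty : t i.castSucc = (b i.succ).1) :
    Nonempty (JPkg p (jctx M x b w t z a τ i.castSucc) (JFacts M x b w t z a c τ)
      (blockAiota (Letters.perc d p) κ a₀ 1 (b i.castSucc).1 (w i.castSucc) (w i.succ) (t i.castSucc))) := by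
  -- degenerate parameters: the piece is empty
  by_cases hP : z i.castSucc = t i.castSucc ∧ (b i.castSucc).1 ≠ t i.castSucc ∧
      (a₀ = 0 → w i.castSucc = (b i.castSucc).1) ∧ (a₀ = 1 → (zdGraph d).Adj (b i.castSucc).1 (w i.castSucc)) ∧
      w i.succ ≠ t i.castSucc ∧ (zdGraph d).Adj (w i.succ) (t i.castSucc)
  swap
  · refine ⟨JPkg.vacuous p _ _ (fun ω K₀ hF => hP ?_) _⟩
    obtain ⟨hzt, hut, -, -, hw0, hw1, -, hw', hadj, -⟩ := midF1_facts M x b w t z a c τ hF i i₀ hk hσ ha ha' hty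
    exact ⟨hzt, hut, hw0, hw1, hw' (by decide), hadj rfl⟩
  obtain ⟨hzt, hut, hw0, hw1, hw't, hadj⟩ := hP
  have hbond : ∀ ω K₀, JFacts M x b w t z a c τ ω K₀ →
      K₀ i.castSucc.succ 1 ∈ (event (eq 1) (w i.succ) (t i.castSucc) : Set (BondConfig (Site d))) := by
    intro ω K₀ hF
    rw [hF.wit_one_midF1 i hσ ha' hty, ← hty]
    exact singleton_mem_event_eq_one hw't
  have hexit : ∀ ω K₀, JFacts M x b w t z a c τ ω K₀ →
      K₀ i.castSucc.castSucc 5 ∈ endX a₀ (b i.castSucc).1 (w i.castSucc) (t i.castSucc) := by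
    intro ω K₀ hF
    have h5 := hF.conn_exit i i₀ hk ha
    rw [hzt] at h5
    unfold endX
    split_ifs with h0
    · rw [hw0 h0] at h5
      rw [event_comm, event_ge]
      exact mem_openConnGe_one_of_ne h5 hut
    · rw [event_comm, event_ge]
      exact mem_openConnGe_zero_of_mem h5
  by_cases h0 : a₀ = 0
  · subst h0
    have hwu : w i.castSucc = (b i.castSucc).1 := hw0 rfl
    by_cases hx : w i.succ = (b i.castSucc).2
    · -- sub-row `x = e`: triangle, exit line of length `≥ 2` by parity
      refine nonempty_jPkg_midF1_core p M x b w t z a τ c i i₀ hk κ hb hσ ha ha' Set.univ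
        (event (eq 1) (w i.succ) (t i.castSucc)) (event (ge 2) (t i.castSucc) (b i.castSucc).1)
        isFinitary_univ (isFinitary_event _ _ _) (isFinitary_event _ _ _)
        (fun ω K₀ hF => ⟨Set.mem_univ _, hbond ω K₀ hF, ?_⟩) ?_
      · have h5 := hF.conn_exit i i₀ hk ha
        rw [hzt, hwu] at h5
        have hadj' : (zdGraph d).Adj (b i.castSucc).1 (b i.castSucc).2 :=
          (zdGraph_adj_iff_stepVec _ _).2 ⟨κ, hb⟩
        have hna : ¬ (zdGraph d).Adj (b i.castSucc).1 (t i.castSucc) :=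
          not_adj_of_adj_adj hadj' (by rw [← hx]; exact hadj)
        rw [event_comm, event_ge]
        refine mem_openConnGe_two_of_notMem h5 hut fun hm => hna ?_
        exact (SimpleGraph.mem_edgeSet _).1 (hF.lattice _ (hF.witness_subset _ 5 hm))
      · refine (junF_midF1_le₃' p M x b w t z a τ i i₀ hk hσ ha ha' _ _ _ _).trans ?_
        rw [hwu, hx]
        exact piPerc_midF1_zero_one_e_le_blockAiota p hb (fun h => hut h.symm) _
    · -- sub-row `x ≠ e`: square
      refine nonempty_jPkg_midF1_core p M x b w t z a τ c i i₀ hk κ hb hσ ha ha'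
        (event (ge 1) (b i.castSucc).2 (w i.succ)) (event (eq 1) (w i.succ) (t i.castSucc))
        (event (ge 1) (t i.castSucc) (b i.castSucc).1)
        (isFinitary_event _ _ _) (isFinitary_event _ _ _) (isFinitary_event _ _ _)
        (fun ω K₀ hF => ⟨?_, hbond ω K₀ hF, ?_⟩) ?_
      · obtain ⟨h0', -⟩ := hF.conn_midE i hσ ha'
        rw [event_ge]; exact mem_openConnGe_one_of_ne h0' (fun h => hx h.symm)
      · have h5 := hexit ω K₀ hF
        rwa [endX, if_pos rfl] at h5
      · refine (junF_midF1_le₄ p M x b w t z a τ i i₀ hk hσ ha ha' _ _ _ _).trans ?_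
        rw [hwu]
        exact piPerc_midF1_zero_one_ne_le_blockAiota p hb (fun h => hut h.symm) _
  · refine nonempty_jPkg_midF1_core p M x b w t z a τ c i i₀ hk κ hb hσ ha ha'
      (event (ge 0) (b i.castSucc).2 (w i.succ)) (event (eq 1) (w i.succ) (t i.castSucc))
      (endX a₀ (b i.castSucc).1 (w i.castSucc) (t i.castSucc))
      (isFinitary_event _ _ _) (isFinitary_event _ _ _) (isFinitary_endX _ _ _ _)
      (fun ω K₀ hF => ⟨?_, hbond ω K₀ hF, hexit ω K₀ hF⟩) ?_
    · obtain ⟨h0', -⟩ := hF.conn_midE i hσ ha'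
      rw [event_ge]; exact mem_openConnGe_zero_of_mem h0'
    · refine (junF_midF1_le₄ p M x b w t z a τ i i₀ hk hσ ha ha' _ _ _ _).trans ?_
      rw [endX, if_neg h0]
      obtain h1 | h2 : a₀ = 1 ∨ a₀ = 2 := by
        fin_cases a₀
        · exact absurd rfl h0
        · exact Or.inl rfl
        · exact Or.inr rfl
      · subst h1
        obtain ⟨κ', hκ'⟩ := (zdGraph_adj_iff_stepVec _ _).1 (hw1 rfl)
        exact piPerc_midF1_one_one_le_blockAiota p hb hκ' _
      · subst h2
        exact piPerc_midF1_two_one_le_blockAiota p hb _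

/-- **Cells `(a, 2)`, `a ∈ {0,1,2}`, variant `F′`**: a package with target `A^{κ,a,2}(u_k, w_k, w_{k+1}, t_k)`.
Exit class `2` of level `k + 1` upgrades the line `w′ → t = u_{k+1}` to `{w′ ←2→ t}` (the bond, if any, is not open
on level `k + 1`).
[cite: FitznerVanDerHofstad2017, §6.1 (6.4), "Case a = 0", "Cases a ≥ 1 and b ≥ 1", "b ≥ 2" (arXiv:1506.07977v2 pp. 58–59); §5.1 (5.4) (p. 48); App. B (p. 75)] -/
theorem nonempty_jPkg_midF1_two (i i₀ : Fin (M + 1)) (hk : i₀.succ = i.castSucc) (κ : Fin d × Bool)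
    (hb : (b i.castSucc).2 = (b i.castSucc).1 + stepVec κ) (hσ : (τ i).1 = true) (a₀ : Fin 3)
    (ha : a i.castSucc = Sum.inl a₀) (ha' : a i.succ = Sum.inl 2) (hty : t i.castSucc = (b i.succ).1) :
    Nonempty (JPkg p (jctx M x b w t z a τ i.castSucc) (JFacts M x b w t z a c τ)
      (blockAiota (Letters.perc d p) κ a₀ 2 (b i.castSucc).1 (w i.castSucc) (w i.succ) (t i.castSucc))) := by
  -- degenerate parameters: the piece is empty
  by_cases hP : z i.castSucc = t i.castSucc ∧ (b i.castSucc).1 ≠ t i.castSucc ∧ (b i.castSucc).1 ≠ w i.succ ∧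
      (a₀ = 0 → w i.castSucc = (b i.castSucc).1) ∧ (a₀ = 1 → (zdGraph d).Adj (b i.castSucc).1 (w i.castSucc)) ∧
      w i.succ ≠ t i.castSucc
  swap
  · refine ⟨JPkg.vacuous p _ _ (fun ω K₀ hF => hP ?_) _⟩
    obtain ⟨hzt, hut, huw', -, hw0, hw1, -, hw', -⟩ := midF1_facts M x b w t z a c τ hF i i₀ hk hσ ha ha' hty
    exact ⟨hzt, hut, huw', hw0, hw1, hw' (by decide)⟩
  obtain ⟨hzt, hut, huw', hw0, hw1, hw't⟩ := hP
  refine nonempty_jPkg_midF1_core p M x b w t z a τ c i i₀ hk κ hb hσ ha ha'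
    (event (ge 0) (b i.castSucc).2 (w i.succ)) (event (ge 2) (w i.succ) (t i.castSucc))
    (endX a₀ (b i.castSucc).1 (w i.castSucc) (t i.castSucc))
    (isFinitary_event _ _ _) (isFinitary_event _ _ _) (isFinitary_endX _ _ _ _) (fun ω K₀ hF => ⟨?_, ?_, ?_⟩) ?_
  · obtain ⟨h0, -⟩ := hF.conn_midE i hσ ha'
    rw [event_ge]; exact mem_openConnGe_zero_of_mem h0
  · -- `w′ → t` of length `≥ 2`: the bond is not open on level `k + 1`
    obtain ⟨-, h1, -⟩ := hF.conn_midE i hσ ha'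
    have hcl := (midF1_facts M x b w t z a c τ hF i i₀ hk hσ ha ha' hty).2.2.2.2.2.2.2.2.2 rfl
    rw [event_ge]
    exact mem_openConnGe_two_of_notMem h1 hw't fun hm => hcl (hF.witness_subset _ 1 hm)
  · have h5 := hF.conn_exit i i₀ hk ha
    rw [hzt] at h5
    unfold endX
    split_ifs with h0
    · rw [hw0 h0] at h5
      rw [event_comm, event_ge]
      exact mem_openConnGe_one_of_ne h5 hut
    · rw [event_comm, event_ge]
      exact mem_openConnGe_zero_of_mem h5
  · refine (junF_midF1_le₄ p M x b w t z a τ i i₀ hk hσ ha ha' _ _ _ _).trans ?_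
    unfold endX
    split_ifs with h0
    · subst h0
      rw [hw0 rfl]
      exact piPerc_midF1_zero_two_le_blockAiota p hb (fun h => hut h.symm) (fun h => huw' h.symm) _
    · obtain h1 | h2 : a₀ = 1 ∨ a₀ = 2 := by
        fin_cases a₀
        · exact absurd rfl h0
        · exact Or.inl rfl
        · exact Or.inr rfl
      · subst h1
        obtain ⟨κ', hκ'⟩ := (zdGraph_adj_iff_stepVec _ _).1 (hw1 rfl)
        exact piPerc_midF1_one_two_le_blockAiota p hb hκ' _
      · subst h2
        exact piPerc_midF1_two_two_le_blockAiota p hb _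

/-- **All nine cells `(a, a′)` of variant `F′` against the primed family**: a package with target
`A'^{κ,a,a′}(u_k, w_k, w_{k+1}, t_k)` (`= A^{κ,a,a′}` off `(a,a′) = (0,0)`).
[cite: FitznerVanDerHofstad2017, §6.1 (6.4) and the Cases a, b ∈ {0, 1, ≥ 2} (arXiv:1506.07977v2 pp. 58–59); §5.1 (5.4) (p. 48); App. B (p. 75)] -/
theorem nonempty_jPkg_midF1' (i i₀ : Fin (M + 1)) (hk : i₀.succ = i.castSucc) (κ : Fin d × Bool)
    (hb : (b i.castSucc).2 = (b i.castSucc).1 + stepVec κ) (hσ : (τ i).1 = true) (a₀ a' : Fin 3)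
    (ha : a i.castSucc = Sum.inl a₀) (ha' : a i.succ = Sum.inl a') (hty : t i.castSucc = (b i.succ).1) :
    Nonempty (JPkg p (jctx M x b w t z a τ i.castSucc) (JFacts M x b w t z a c τ)
      (blockAiota' (Letters.perc d p) κ a₀ a' (b i.castSucc).1 (w i.castSucc) (w i.succ) (t i.castSucc))) := by
  obtain h0 | h1 | h2 : a' = 0 ∨ a' = 1 ∨ a' = 2 := by
    fin_cases a'
    · exact Or.inl rfl
    · exact Or.inr (Or.inl rfl)
    · exact Or.inr (Or.inr rfl)
  · subst h0
    exact nonempty_jPkg_midF1_zero' p M x b w t z a c τ i i₀ hk κ hb hσ a₀ ha ha' hty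
  · subst h1
    rw [blockAiota'_of_ne _ _ (fun h => absurd h.2 (by decide))]
    exact nonempty_jPkg_midF1_one p M x b w t z a c τ i i₀ hk κ hb hσ a₀ ha ha' hty
  · subst h2
    rw [blockAiota'_of_ne _ _ (fun h => absurd h.2 (by decide))]
    exact nonempty_jPkg_midF1_two p M x b w t z a c τ i i₀ hk κ hb hσ a₀ ha ha' hty

/-- **The eight cells `(a, a′) ≠ (0,0)` of variant `F′` against the landed (App. B) family**: a package with target
`A^{κ,a,a′}(u_k, w_k, w_{k+1}, t_k)`.
[cite: FitznerVanDerHofstad2017, §6.1 (6.4) and the Cases a, b ∈ {0, 1, ≥ 2} (arXiv:1506.07977v2 pp. 58–59); §5.1 (5.4) (p. 48); App. B (p. 75)] -/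
theorem nonempty_jPkg_midF1 (i i₀ : Fin (M + 1)) (hk : i₀.succ = i.castSucc) (κ : Fin d × Bool)
    (hb : (b i.castSucc).2 = (b i.castSucc).1 + stepVec κ) (hσ : (τ i).1 = true) (a₀ a' : Fin 3)
    (h00 : ¬ (a₀ = 0 ∧ a' = 0)) (ha : a i.castSucc = Sum.inl a₀) (ha' : a i.succ = Sum.inl a')
    (hty : t i.castSucc = (b i.succ).1) :
    Nonempty (JPkg p (jctx M x b w t z a τ i.castSucc) (JFacts M x b w t z a c τ)
      (blockAiota (Letters.perc d p) κ a₀ a' (b i.castSucc).1 (w i.castSucc) (w i.succ) (t i.castSucc))) := by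
  rw [← blockAiota'_of_ne _ _ h00]
  exact nonempty_jPkg_midF1' p M x b w t z a c τ i i₀ hk κ hb hσ a₀ a' ha ha' hty

/-- **The cells of variant `F′` in the literal shape of the second term of the pointwise block (5.4)**
(`NobleBlocksPointwise.blockBpt`): target `δ_{z_k,t_k} (A'^{κ,a,a′}(u_k,w_k,w_{k+1},t_k) P^{S,0}(u_{k+1}−t_k, u_{k+1}−t_k))`
(`= A'^{κ,a,a′}(…)` on the regime: `z_k ≠ t_k` is vacuous, and `P^{S,0}(0,0) = 1`), primed family.
[cite: FitznerVanDerHofstad2017, §5.1 (5.4) second term (arXiv:1506.07977v2 p. 48); §6.1 (6.4) (p. 58); App. B (pp. 73, 75)] -/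
theorem nonempty_jPkg_midF1_term₂' (i i₀ : Fin (M + 1)) (hk : i₀.succ = i.castSucc) (κ : Fin d × Bool)
    (hb : (b i.castSucc).2 = (b i.castSucc).1 + stepVec κ) (hσ : (τ i).1 = true) (a₀ a' : Fin 3)
    (ha : a i.castSucc = Sum.inl a₀) (ha' : a i.succ = Sum.inl a') (hty : t i.castSucc = (b i.succ).1) :
    Nonempty (JPkg p (jctx M x b w t z a τ i.castSucc) (JFacts M x b w t z a c τ)
      (kd (z i.castSucc) (t i.castSucc) *
        (blockAiota' (Letters.perc d p) κ a₀ a' (b i.castSucc).1 (w i.castSucc) (w i.succ) (t i.castSucc) *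
          blockPS (Letters.perc d p) 0 ((b i.succ).1 - t i.castSucc) ((b i.succ).1 - t i.castSucc)))) := by
  by_cases hzt : z i.castSucc = t i.castSucc
  · rw [hzt, kd_self, one_mul, ← hty, sub_self, blockPS_zero_origin, mul_one]
    exact nonempty_jPkg_midF1' p M x b w t z a c τ i i₀ hk κ hb hσ a₀ a' ha ha' hty
  · exact nonempty_jPkg_of_midE_t_eq_z_ne p M x b w t z a c τ _ i hσ ha' hty hzt _

/-- **The cells `(a, a′) ≠ (0,0)` of variant `F′` in the literal shape of the second term of (5.4)**, landed family:
target `δ_{z_k,t_k} (A^{κ,a,a′}(u_k,w_k,w_{k+1},t_k) P^{S,0}(u_{k+1}−t_k, u_{k+1}−t_k))`.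
[cite: FitznerVanDerHofstad2017, §5.1 (5.4) second term (arXiv:1506.07977v2 p. 48); §6.1 (6.4) (p. 58); App. B (pp. 73, 75)] -/
theorem nonempty_jPkg_midF1_term₂ (i i₀ : Fin (M + 1)) (hk : i₀.succ = i.castSucc) (κ : Fin d × Bool)
    (hb : (b i.castSucc).2 = (b i.castSucc).1 + stepVec κ) (hσ : (τ i).1 = true) (a₀ a' : Fin 3)
    (h00 : ¬ (a₀ = 0 ∧ a' = 0)) (ha : a i.castSucc = Sum.inl a₀) (ha' : a i.succ = Sum.inl a')
    (hty : t i.castSucc = (b i.succ).1) :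
    Nonempty (JPkg p (jctx M x b w t z a τ i.castSucc) (JFacts M x b w t z a c τ)
      (kd (z i.castSucc) (t i.castSucc) *
        (blockAiota (Letters.perc d p) κ a₀ a' (b i.castSucc).1 (w i.castSucc) (w i.succ) (t i.castSucc) *
          blockPS (Letters.perc d p) 0 ((b i.succ).1 - t i.castSucc) ((b i.succ).1 - t i.castSucc)))) := by
  rw [← blockAiota'_of_ne _ _ h00]
  exact nonempty_jPkg_midF1_term₂' p M x b w t z a c τ i i₀ hk κ hb hσ a₀ a' ha ha' hty

end Packages

end Literature.Probability.FitznerVanDerHofstad2017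

end
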